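import Summits.HubbardSuperconductivity.HubbardSuperconductivity.Theorems.AnisotropyChordTransferFibre3KT1Targets
import Summits.HubbardSuperconductivity.HubbardSuperconductivity.Theorems.AnisotropyChordTransferFibre3Dirichlet

/-!
# Route `AnisotropyChord` / H0 rotor rung: PartN33 Layer C, T3(ii) — `TauTailBound` PROVED

PartN33 = `…Fibre3KT1Targets` (theory seat `hubbard-h0-rotor-theory-1`, memo 21 §298(a)), the tail toolkit T3.
This file proves the elementary Fourier bound behind T3(ii):

* `abs_re_dft_le_sum` — for a pointwise non-negative `g : Tor L → ℝ` and every momentum `k`,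
  `|Re ĝ(k)| ≤ Σ_r g(r)` (`|e^{−ik·r}| = 1` and the triangle inequality);
* **`tauTailBound_holds (Δ) : TauTailBound L Δ`** — `|τ_e(k)| ≤ Σ_r (D_e s)(r)² = ‖D_e s‖²`, i.e. the case `g = (D_e s)²`.

No hypothesis on `L`, `Δ` or the pair function is needed (the statement is about the Fourier transform of a square).
Nothing here proves superconductivity in the Hubbard model; this is a helper lemma of ONE conditional reduction
(rung stmt-HubbardSuperconductivity-19089).  Prover seat `hubbard-h0-rotor-p3` g0; `--supports stmt-HubbardSuperconductivity-19089`.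
-/

set_option linter.dupNamespace false
set_option autoImplicit false

noncomputable section

open scoped BigOperators
open Complex

namespace Summit.HubbardSuperconductivity.HubbardSuperconductivity.Theorems.AnisotropyChord.Transfer.Fibre3

variable (L : ℕ) [NeZero L]

/-! ## The Fourier transform of a non-negative function is bounded by its value at `k = 0` -/

/-- one summand of `dft`: `‖conj φ_k(r) · g(r)‖ = |g(r)|`. [folklore] -/
theorem norm_conj_phase_mul_ofReal (g : Tor L → ℝ) (k r : Tor L) :
    ‖(starRingEnd ℂ) (phase L k r) * (g r : ℂ)‖ = |g r| := by
  rw [norm_mul, RCLike.norm_conj, norm_phase, one_mul, Complex.norm_real, Real.norm_eq_abs]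

/-- `‖ĝ(k)‖ ≤ Σ_r |g(r)|`. [folklore] -/
theorem norm_dft_le_sum_abs (g : Tor L → ℝ) (k : Tor L) : ‖dft L g k‖ ≤ ∑ r : Tor L, |g r| := by
  unfold dft
  refine (norm_sum_le _ _).trans ?_
  refine Finset.sum_le_sum fun r _ => ?_
  rw [norm_conj_phase_mul_ofReal]

/-- **`|Re ĝ(k)| ≤ Σ_r g(r)` for `g ≥ 0`** (the Fourier transform of a non-negative function is dominated by its
`k = 0` value). [folklore] -/
theorem abs_re_dft_le_sum {g : Tor L → ℝ} (hg : ∀ r : Tor L, 0 ≤ g r) (k : Tor L) :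
    |(dft L g k).re| ≤ ∑ r : Tor L, g r := by
  refine (Complex.abs_re_le_norm _).trans ?_
  refine (norm_dft_le_sum_abs L g k).trans ?_
  refine le_of_eq (Finset.sum_congr rfl fun r _ => ?_)
  exact abs_of_nonneg (hg r)

/-- `Re ĝ(k) ≤ Σ_r g(r)` for `g ≥ 0`. [folklore] -/
theorem re_dft_le_sum {g : Tor L → ℝ} (hg : ∀ r : Tor L, 0 ≤ g r) (k : Tor L) :
    (dft L g k).re ≤ ∑ r : Tor L, g r :=
  (le_abs_self _).trans (abs_re_dft_le_sum L hg k)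

/-! ## `TauTailBound` -/

/-- ★ **`TauTailBound L Δ` holds** (every `L`, every `Δ`): `|τ_e(k)| ≤ ‖D_e s‖²`. [folklore] -/
theorem tauTailBound_holds (Δ : ℝ) : TauTailBound L Δ := by
  intro f e k
  unfold taufun
  exact abs_re_dft_le_sum L (fun r => sq_nonneg _) k

end Summit.HubbardSuperconductivity.HubbardSuperconductivity.Theorems.AnisotropyChord.Transfer.Fibre3

end
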